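import Summits.Ventures.PercRepro.RankLevelSetUpClassCut

/-! # RankLevelSetUpFour — (↑) AT EVERY LEVEL `≤ 4` ON EVERY MATROID OF NULLITY `≤ 4`, AND (★★) AT LEVEL `5` AND
MONO'S STEP `5` FOR EVERY FINITE MATROID — UNCONDITIONALLY (night-1 g39; dossier §51; on `RankLevelSetUpClassCut`)

The strong induction of `upAt_of_nullity_four_of_claim` is re-run with the series-class case settled by
`upAt_four_of_seriesClass_of_ih` (the class-cut reduction, which uses the inductive hypothesis on the matroid with
the class cut to two elements) instead of the claim on elementary quotient pairs: **`upAt_of_nullity_four`** — (↑)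
at every level `k ≤ 4` with `2k + 2 ≤ #E` on every matroid of nullity `≤ 4`. Through
`perElemAt_five_of_coloopFree_of_up_nullity` and the reductions of level `5` (loops, parallel pairs, coloops):
**`perElemAt_five`** — (★★) at level `5` for every finite matroid with `≥ 12` elements at every element, and
**`mono_step_five`** — `(#E − 5) · D_5 ≤ 6 · D_6`; hence (★★) at every level `j ≤ 5` (**`perElemAt_le_five`**) and the
class theorems **`biIndepPerElem_of_ncard_le_thirteen`** / **`biIndepMono_of_ncard_le_thirteen`** (every matroid with
`≤ 13` elements) and **`biIndepPerElem_of_eRank_le_seven`** / **`biIndepMono_of_eRank_le_seven`** (every matroid of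
rank `≤ 7`). No hypothesis beyond finiteness. Every declaration has a docstring;
imports: the cell's own modules and Mathlib only. Axioms: standard. -/

namespace PercRepro

open Set Matroid

variable {α : Type} (M : Matroid α) [M.Finite]

/-- **(↑) AT EVERY LEVEL `k ≤ 4` ON EVERY MATROID OF NULLITY `≤ 4`** (`2k + 2 ≤ #E`): strong induction on `#E`,
removing coloops (`upAt_of_isColoop`, `upAt_self_of_isColoop` with `biIndepMono_of_nullity`); on a coloop-free
matroid: nullity `≤ 3` by the chain, nullity `4` and `k < 4` trivially, `k = 4` by `upAt_four_of_no_triple` without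
a series triple, and with one by `upAt_four_of_mem_seriesClass` (inside the class) or
`upAt_four_of_seriesClass_of_ih` (outside it, from the inductive hypothesis on the class cut to two elements). -/
theorem upAt_of_nullity_four :
    ∀ n : ℕ, ∀ (M' : Matroid α) [M'.Finite], M'.E.ncard = n → M'✶.eRank ≤ 4 → ∀ k : ℕ, k ≤ 4 → 2 * k + 2 ≤ n →
      ∀ b ∈ M'.E, BiIndepUpAt M' b k := by
  intro n
  induction n using Nat.strong_induction_on with
  | _ n ih =>
    intro M' _ hn hν k hk4 hkn b hb
    by_cases hcol : ∃ c, M'.IsColoop c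
    · obtain ⟨c, hc⟩ := hcol
      haveI := delete_finite' M' c
      have hcard : (M'.delete {c}).E.ncard = n - 1 := by
        rw [Matroid.delete_ground, Set.ncard_sdiff_singleton_of_mem hc.mem_ground, hn]
      have hν' : (M'.delete {c})✶.eRank ≤ 4 := (eRank_dual_delete_isColoop_le M' hc).trans hν
      rcases Nat.lt_or_ge k 1 with hk0 | hk1
      · have : k = 0 := by omega
        subst this
        exact upAt_zero M' b
      obtain ⟨k', rfl⟩ : ∃ k', k = k' + 1 := ⟨k - 1, by omega⟩
      by_cases hbc : b = c
      · subst hbc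
        exact upAt_self_of_isColoop M' hc (by omega) (biIndepMono_of_nullity (M'.delete {b}) hν')
      · have hbM : b ∈ (M'.delete {c}).E := by
          rw [Matroid.delete_ground]; exact ⟨hb, by simpa using hbc⟩
        refine upAt_of_isColoop M' hc hbc ?_ ?_
        · rcases Nat.lt_or_ge (2 * (k' + 1) + 2) n with hlt | hge
          · exact ih (n - 1) (by omega) (M'.delete {c}) hcard hν' (k' + 1) hk4 (by omega) b hbM
          · -- the exact middle of `M' ＼ c`
            rw [upAt_iff_through_le_through _ hbM (by omega), hcard]
            have e : n - 1 - 1 - (k' + 1) = k' + 1 := by omega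
            rw [e]
        · exact ih (n - 1) (by omega) (M'.delete {c}) hcard hν' k' (by omega) (by omega) b hbM
    · simp only [not_exists] at hcol
      by_cases h3 : M'✶.eRank ≤ 3
      · exact upAt_of_coloopFree_of_nullity_three M' hcol h3 hb (by omega)
      · have h4 : M'✶.eRank = 4 := eRank_dual_eq_four_of_not_le_three M' hν h3
        rcases Nat.lt_or_ge k 4 with hk | hk
        · refine upAt_of_lt_nullity M' ?_
          rw [h4]; exact_mod_cast hk
        · have hk' : k = 4 := by omega
          subst hk'
          by_cases hnt : NoSeriesTriple M'
          · exact upAt_four_of_no_triple M' hcol hν hnt hb (by omega)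
          · obtain ⟨p, hp, hq⟩ := three_le_ncard_seriesClass_of_not_noSeriesTriple M' hnt
            by_cases hbP : b ∈ M'✶.closure {p}
            · exact upAt_four_of_mem_seriesClass M' hcol h4 hp hq hbP
            · refine upAt_four_of_seriesClass_of_ih M' hcol h4 hp hq hb hbP (by omega) ?_
              intro M'' _ hlt hν'' h10 b'' hb''
              exact ih M''.E.ncard (by omega) M'' rfl hν'' 4 le_rfl h10 b'' hb''

/-- **(↑) AT LEVEL `4` ON EVERY MATROID OF NULLITY `≤ 4` WITH `≥ 10` ELEMENTS, AT EVERY ELEMENT.** -/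
theorem upAt_four_of_nullity_le_four (hν : M✶.eRank ≤ 4) (hn : 10 ≤ M.E.ncard) {b : α} (hb : b ∈ M.E) :
    BiIndepUpAt M b 4 :=
  upAt_of_nullity_four M.E.ncard M rfl hν 4 le_rfl hn b hb

/-- **(★★) AT LEVEL `5` ON A COLOOP-FREE MATROID AT AN ELEMENT IN NO PARALLEL PAIR** (`11 < #E`). -/
theorem perElemAt_five_of_coloopFree (hcol : ∀ e, ¬ M.IsColoop e) {y : α} (hy : y ∈ M.E)
    (hnp : ∀ z, z ≠ y → y ∉ M.closure {z}) (hn : 2 * 5 + 1 < M.E.ncard) :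
    {Z ∈ biIndep M 5 | y ∉ Z}.ncard ≤ {Q ∈ biIndep M 6 | y ∈ Q}.ncard :=
  perElemAt_five_of_coloopFree_of_up_nullity M hcol hy hnp hn
    (fun N _ hν hn10 _ hb => upAt_four_of_nullity_le_four N hν hn10 hb)

/-- **(★★) AT LEVEL `5` FOR EVERY FINITE MATROID WITH `≥ 12` ELEMENTS**: the reductions of
`perElemAt_five_of_claim_aux` (a loop kills every level, a parallel pair sends level `5` to level `4` of the minor,
a coloop splits into the levels `4` and `5` of its deletion) on top of `perElemAt_five_of_coloopFree`. -/
theorem perElemAt_five_aux :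
    ∀ n : ℕ, ∀ (M' : Matroid α) [M'.Finite], M'.E.ncard = n →
      ∀ y ∈ M'.E, 12 ≤ n → {Z ∈ biIndep M' 5 | y ∉ Z}.ncard ≤ {Q ∈ biIndep M' 6 | y ∈ Q}.ncard := by
  intro n
  induction n using Nat.strong_induction_on with
  | _ n ih =>
    intro M' _ hn y hy h12
    by_cases hloop : ∃ ℓ, M'.IsLoop ℓ
    · obtain ⟨ℓ, hℓ⟩ := hloop
      have : {Z ∈ biIndep M' 5 | y ∉ Z} = ∅ := by
        rw [biIndep_eq_empty_of_isLoop M' hℓ 5]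
        ext Z; simp
      rw [this, Set.ncard_empty]
      exact Nat.zero_le _
    simp only [not_exists] at hloop
    by_cases hpar : ∃ u v, ParallelPair M' u v
    · obtain ⟨u, v, huv⟩ := hpar
      haveI := contract_delete_finite M' u v
      have hcard := ncard_ground_contract_delete M' huv
      have hD : ∀ {u v : α} (h : ParallelPair M' u v),
          biIndepCount ((M'.contract {u}).delete {v}) 4 ≤ biIndepCount ((M'.contract {u}).delete {v}) 5 := by
        intro u v h
        haveI := contract_delete_finite M' u v
        have hc := ncard_ground_contract_delete M' h
        exact biIndepCount_four_le_five ((M'.contract {u}).delete {v}) (by rw [hc]; omega)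
      by_cases hyu : y = u
      · subst hyu
        exact perElem_succ_of_parallel_self M' huv 4 (hD huv)
      by_cases hyv : y = v
      · subst hyv
        exact perElem_succ_of_parallel_self M' huv.symm 4 (hD huv.symm)
      · have hyN : y ∈ ((M'.contract {u}).delete {v}).E := by
          rw [ground_contract_delete]
          exact ⟨hy, by simp only [Set.mem_insert_iff, Set.mem_singleton_iff, not_or]; exact ⟨hyu, hyv⟩⟩
        exact perElem_succ_of_parallel_other M' huv hyu hyv 4
          (perElemAt_four ((M'.contract {u}).delete {v}) hyN (by rw [hcard]; omega))
    simp only [not_exists] at hpar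
    by_cases hcol : ∃ x, M'.IsColoop x
    · obtain ⟨x, hx⟩ := hcol
      haveI := delete_finite' M' x
      have hcard : (M'.delete {x}).E.ncard = n - 1 := by
        rw [Matroid.delete_ground, Set.ncard_sdiff_singleton_of_mem hx.mem_ground, hn]
      by_cases hyx : y = x
      · subst hyx
        exact (perElem_coloop_self M' hx 5).le
      · have hyM : y ∈ (M'.delete {x}).E := by
          rw [Matroid.delete_ground]
          exact ⟨hy, by simpa using hyx⟩
        refine perElem_succ_of_coloop M' hx hyx 4 (perElemAt_four (M'.delete {x}) hyM (by omega)) ?_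
        rcases Nat.lt_or_ge (n - 1) 12 with h11 | h12'
        · exact (perElem_middle_eq (M'.delete {x}) hyM 5 (by omega)).le
        · exact ih (n - 1) (by omega) (M'.delete {x}) hcard y hyM h12'
    simp only [not_exists] at hcol
    exact perElemAt_five_of_coloopFree M' hcol hy
      (fun _ hz => notMem_closure_singleton_of_no_partner M' hy (hloop y) (hpar y) hz) (by omega)

/-- **(★★) AT LEVEL `5` FOR EVERY FINITE MATROID AND EVERY ELEMENT** (`12 ≤ #E`):
`#{Z ∈ D_5 : y ∉ Z} ≤ #{Q ∈ D_6 : y ∈ Q}`. -/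
theorem perElemAt_five {y : α} (hy : y ∈ M.E) (hn : 12 ≤ M.E.ncard) :
    {Z ∈ biIndep M 5 | y ∉ Z}.ncard ≤ {Q ∈ biIndep M 6 | y ∈ Q}.ncard :=
  perElemAt_five_aux M.E.ncard M rfl y hy hn

/-- **MONO'S STEP `j = 5` FOR EVERY FINITE MATROID**: `(#E − 5) · D_5 ≤ 6 · D_6` for `12 ≤ #E`. -/
theorem mono_step_five (hn : 12 ≤ M.E.ncard) : (M.E.ncard - 5) * biIndepCount M 5 ≤ 6 * biIndepCount M 6 :=
  mono_step_of_perElemAt M 5 (fun _ hy => perElemAt_five M hy hn)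

/-- `D_5 ≤ D_6` on `12 ≤ #E` elements. -/
lemma biIndepCount_five_le_six (hn : 12 ≤ M.E.ncard) : biIndepCount M 5 ≤ biIndepCount M 6 := by
  have h := mono_step_five M hn
  have h6 : 6 * biIndepCount M 5 ≤ (M.E.ncard - 5) * biIndepCount M 5 :=
    Nat.mul_le_mul_right _ (by omega)
  omega

/-! ## Class theorems -/

/-- **(★★) at every level `j ≤ 5`** for every finite matroid and every element, whenever `2j + 1 < #E`. -/
theorem perElemAt_le_five {y : α} (hy : y ∈ M.E) {j : ℕ} (hj : j ≤ 5) (hn : 2 * j + 1 < M.E.ncard) :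
    {Z ∈ biIndep M j | y ∉ Z}.ncard ≤ {Q ∈ biIndep M (j + 1) | y ∈ Q}.ncard := by
  rcases Nat.lt_or_ge j 5 with h4 | h5
  · exact perElemAt_le_four M hy (by omega) hn
  · have hj5 : j = 5 := by omega
    subst hj5
    exact perElemAt_five M hy (by omega)

/-- **(★★) holds on every matroid with at most `13` elements**: every level in range has `j ≤ 5`. -/
theorem biIndepPerElem_of_ncard_le_thirteen (hn : M.E.ncard ≤ 13) : BiIndepPerElem M :=
  fun _ hy j hj => perElemAt_le_five M hy (by omega) hj

/-- **Mono holds on every matroid with at most `13` elements**. -/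
theorem biIndepMono_of_ncard_le_thirteen (hn : M.E.ncard ≤ 13) : BiIndepMono M :=
  biIndepMono_of_perElem M (biIndepPerElem_of_ncard_le_thirteen M hn)

/-- **(★★) holds on every matroid of rank at most `7`**: at a level `j ≥ 6` with `2j + 1 < #E` a bi-independent
`j`-set would have an independent complement of `#E − j ≥ 8` elements. -/
theorem biIndepPerElem_of_eRank_le_seven (hr : M.eRank ≤ 7) : BiIndepPerElem M := by
  intro y hy j hj
  rcases Nat.lt_or_ge j 6 with h5 | h6
  · exact perElemAt_le_five M hy (by omega) hj
  · have hempty : biIndep M j = ∅ := by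
      refine biIndep_eq_empty_of_eRank_lt M (lt_of_le_of_lt hr ?_)
      have h8 : (8 : ℕ) ≤ M.E.ncard - j := by omega
      calc (7 : ℕ∞) < ((8 : ℕ) : ℕ∞) := by norm_num
        _ ≤ ((M.E.ncard - j : ℕ) : ℕ∞) := by exact_mod_cast h8
    have hL : {Z ∈ biIndep M j | y ∉ Z} = ∅ := by
      rw [hempty]
      ext Z
      simp
    rw [hL, Set.ncard_empty]
    exact Nat.zero_le _

/-- **Mono holds on every matroid of rank at most `7`**. -/
theorem biIndepMono_of_eRank_le_seven (hr : M.eRank ≤ 7) : BiIndepMono M :=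
  biIndepMono_of_perElem M (biIndepPerElem_of_eRank_le_seven M hr)

end PercRepro
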